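import Literature.Topology.FourManifolds.LefschetzHandlebody
import Summits.SmoothPoincare4.SmoothPoincare4.Theorems.ConvexBisectionAcyclicBisectionExistsMultiAttachmentHomologyLoops
import Summits.SmoothPoincare4.SmoothPoincare4.Theorems.ConvexBisectionAcyclicBisectionExistsMultiAttachmentH1Cores
import Summits.SmoothPoincare4.SmoothPoincare4.Theorems.ConvexBisectionAcyclicBisectionExistsKasLoops
import Summits.SmoothPoincare4.SmoothPoincare4.Theorems.ConvexBisectionAcyclicBisectionExistsKasSeamCover
import Summits.SmoothPoincare4.SmoothPoincare4.Theorems.ConvexBisectionAcyclicBisectionExistsKasSeamMV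
import HarnessLib

/-!
# Kas' seam quotient (D): `H₁(∂X; ℤ) ≅ H₁(∂ Base g ∖ ⋃ Kᵢ; ℤ) ⧸ ⟨longitudes⟩`, from the models
(helper for stub `stub_modelsOn_counts` = NF2, clause 3 = Kas' presentation of `H₁(∂X(F; l); ℤ)`;
line `modp-braid-orbits` r9, crux `ConvexBisection.AcyclicBisectionExists`, item
stmt-SmoothPoincare4-10508; wave 4 / W4-D, design lemma (D) `Kas_seam_quotient` of
`work/stubs/Kas_Design.lean`.)

**`Kas_seam_quotient_of`** (= registered sub-goal stub `stub_Kas_seam_quotient_of`; the unconditional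
(D) `Kas_seam_quotient` is assembled in `…KasSeamQuotientFinal.lean` from the model files): for
multi-attachment data `D` of 2-handles on `Base g` and a boundary datum `bX` of `X`,
`H₁(bX.carrier; ℤ) ≃ₗ[ℤ] H₁(seamOff h; ℤ) ⧸ span {ℓᵢ}` (`ℓᵢ = longClass`, the Clifford longitude of
the `i`-th attaching circle pushed into the seam off the cores), GIVEN the homology of the two
models: the tube seam `tubeSeam = (T ∖ S) ∩ S³ ≅ T² × ℝ` and the sphere off the core
`sphereOffCore = S³ ∖ S ≅ D² × S¹` are path connected, and the inclusion `tubeSeam → sphereOffCore`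
is onto on `H₁` with kernel `ℤ · [model longitude]` (hypotheses (M1)–(M4); they follow from
`Kas_tubeSeam_homology`, `Kas_sphereOffCore_homology` of the design plus the generation of
`H₁(S³ ∖ S)` by the meridian: `ker_and_surjective_of_models`).  Proof: the cover
`∂X = U ∪ ⋃ Wᵢ` of `Kas_seamCover` (`U ≃ₜ seamOff h`, `Wᵢ ≃ₜ sphereOffCore`) has overlaps
`U ∩ Wᵢ ≃ₜ tubeSeam` (§1, Kosinski's identification `x ∼ h̄ᵢ α(x)` read on `S³`;
`exists_homeomorph_tubeSeam`), compatibly with the inclusion into `Wᵢ` and — `α` being the identity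
on the Clifford torus (`handleInversion_cliffordVec`) — carrying the model longitude to `longMap`;
then `stub_Kas_seamMV` (`surjective_and_ker_cover_of_surjective_right`) and transport along `eU`.

Everything is proved; no named facts, no `sorry`.  References: A. Kas, Pacific J. Math. 89 (1980)
[Kas1980]; R. E. Gompf, A. I. Stipsicz, *4-Manifolds and Kirby Calculus* (1999), §8.2
[GompfStipsicz1999]; A. A. Kosinski, *Differential Manifolds* (1993), VI §6 [Kosinski1993];
A. Hatcher, *Algebraic Topology* (2002), §2.2, Thm. 2A.1 [HatcherAT2002].
-/

noncomputable section

-- the prescribed namespace `Summit.<P>.<Sub>.…` duplicates `SmoothPoincare4` (P = Sub)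
set_option linter.dupNamespace false

open scoped Manifold ContDiff Topology
open Set Function Metric CategoryTheory
open Literature.Topology.FourManifolds Literature.Topology.FourManifolds.LefschetzBase
  Literature.AlgebraicTopology.SingularHomology Literature.Topology.FourManifolds.HandleAttachingMap

namespace Summit.SmoothPoincare4.SmoothPoincare4.Theorems.AcyclicBisectionExists.ModpBraidOrbits

/-! ## §1 The overlap `U ∩ Wᵢ` is the tube seam -/

section Overlap

/-- **Kosinski's inversion `α` is the identity on the Clifford torus** (`|x_λ|² = ½`:
`√(1 − ½)/√½ = 1`). [cite: Kosinski1993, VI (6.1)] -/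
theorem handleInversion_cliffordVec (θ φ : sphere (0 : EuclideanSpace ℝ (Fin 2)) 1) :
    handleInversion 2 (cliffordVec θ φ) = cliffordVec θ φ := by
  have hl : lamSq 2 (cliffordVec θ φ) = 1 / 2 := lamSq_cliffordVec θ φ
  have h1 : 1 - lamSq 2 (cliffordVec θ φ) = 1 / 2 := by rw [hl]; norm_num
  have hne : Real.sqrt (1 / 2) ≠ 0 := (Real.sqrt_pos.2 (by norm_num)).ne'
  ext i
  rw [handleInversion_apply, h1, hl, div_self hne]
  split_ifs <;> rw [mul_one]

variable {g : ℕ} {l : List ((Fin g ⊕ Fin g → ℤ) × Bool)}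
  {h : Fin l.length → HandleAttachingMap 3 2 (Base g)}
  {X : Type} [TopologicalSpace X] [ChartedSpace (EuclideanHalfSpace 4) X]

/-- `h̄ᵢ(α y)` lies off all the cores, for `y` in the tube seam. [cite: Kosinski1993, VI §6] -/
theorem toFun_invPt_mem_coresComplement (D : MultiAttachmentData h (𝓡∂ 4) X) (i : Fin l.length)
    (y : ↥tubeSeam) : (h i).toFun (handleInversionPt y.1.1 y.1.2 y.2.2) ∈ coresComplement h := by
  have hm : (h i).toFun (handleInversionPt y.1.1 y.1.2 y.2.2) ∈ (⋃ j, (h j).core)ᶜ ∩ range (h i).toFun := by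
    rw [compl_iUnion_core_inter_range₄ D.disjoint i]
    exact ⟨handleInversionPt y.1.1 y.1.2 y.2.2, (handleInversion_mem y.1.2 y.2.2).2.2, rfl⟩
  exact hm.1

/-- **Kosinski's identification on the sphere**: `jA (h̄ᵢ (α y)) = jBᵢ (y)` for `y` in the tube seam.
[cite: Kosinski1993, VI §6] -/
theorem jA_invPt_eq_jB (D : MultiAttachmentData h (𝓡∂ 4) X) (i : Fin l.length) (y : ↥tubeSeam) :
    D.jA ⟨(h i).toFun (handleInversionPt y.1.1 y.1.2 y.2.2), toFun_invPt_mem_coresComplement D i y⟩ =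
      D.jB i (tubeSeamToSphereOffCore y : ↥sphereOffCore) := by
  rw [D.glue i]
  refine ⟨handleInversionPt y.1.1 y.1.2 y.2.2, (handleInversion_mem y.1.2 y.2.2).2.2, ?_, rfl⟩
  show ((y.1 : closedBall (0 : EuclideanSpace ℝ (Fin 4)) 1) : EuclideanSpace ℝ (Fin 4)) =
    handleInversion 2 (handleInversion 2 ((y.1 : closedBall (0 : EuclideanSpace ℝ (Fin 4)) 1) :
      EuclideanSpace ℝ (Fin 4)))
  rw [handleInversion_handleInversion (lt_of_le_of_ne (lamSq_nonneg 2 _) (Ne.symm y.1.2))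
    (lt_of_le_of_ne (lamSq_le_one (mem_closedBall_zero_iff.1 y.1.1.2)) y.2.2)]

/-- **The overlap `U ∩ Wᵢ` of the cover of the seam is the tube seam**: a homeomorphism
`tubeSeam ≃ₜ U ∩ Wᵢ` over `Wᵢ ≃ₜ sphereOffCore`, under which `incl` reads `jA ∘ h̄ᵢ ∘ α`.
[cite: Kosinski1993, VI §6] -/
theorem exists_homeomorph_tubeSeam (D : MultiAttachmentData h (𝓡∂ 4) X)
    (bX : BoundaryData (𝓡∂ 4) X (𝓡 3)) (i : Fin l.length)
    (eW : ↥(bX.incl ⁻¹' range (D.jB i)) ≃ₜ ↥sphereOffCore)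
    (heW : ∀ y, D.jB i ((eW y : ↥sphereOffCore) : ↥(beltPiece 3 2)) = bX.incl y) :
    ∃ eT : ↥tubeSeam ≃ₜ ↥((bX.incl ⁻¹' range D.jA) ∩ (bX.incl ⁻¹' range (D.jB i))),
      (∀ y, ((eT y : ↥((bX.incl ⁻¹' range D.jA) ∩ (bX.incl ⁻¹' range (D.jB i)))) : bX.carrier) =
        ((eW.symm (tubeSeamToSphereOffCore y) : ↥(bX.incl ⁻¹' range (D.jB i))) : bX.carrier)) ∧
      ∀ y, bX.incl (eT y) =
        D.jA ⟨(h i).toFun (handleInversionPt y.1.1 y.1.2 y.2.2), toFun_invPt_mem_coresComplement D i y⟩ := by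
  -- `incl (eW⁻¹ z) = jB z`
  have heW' : ∀ z : ↥sphereOffCore, bX.incl (eW.symm z) = D.jB i (z : ↥(beltPiece 3 2)) := by
    intro z
    rw [← heW (eW.symm z), Homeomorph.apply_symm_apply]
  have hA : ∀ y : ↥tubeSeam, ((eW.symm (tubeSeamToSphereOffCore y) :
      ↥(bX.incl ⁻¹' range (D.jB i))) : bX.carrier) ∈ bX.incl ⁻¹' range D.jA := fun y =>
    ⟨_, (jA_invPt_eq_jB D i y).trans (heW' _).symm⟩
  -- points of `U ∩ Wᵢ` read in `sphereOffCore` lie in the tube (`x_λ ≠ 0`)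
  have hT : ∀ z : ↥((bX.incl ⁻¹' range D.jA) ∩ (bX.incl ⁻¹' range (D.jB i))),
      lamSq 2 ((((eW ⟨z, z.2.2⟩ : ↥sphereOffCore) : ↥(beltPiece 3 2)) :
        closedBall (0 : EuclideanSpace ℝ (Fin 4)) 1) : EuclideanSpace ℝ (Fin 4)) ≠ 0 := by
    intro z
    obtain ⟨a, ha⟩ := z.2.1
    have hg : D.jA a = D.jB i ((eW ⟨z, z.2.2⟩ : ↥sphereOffCore) : ↥(beltPiece 3 2)) := by
      rw [heW]; exact ha
    exact ((D.glue i _ _).1 hg).lamSq_ne_zero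
  let inv : ↥((bX.incl ⁻¹' range D.jA) ∩ (bX.incl ⁻¹' range (D.jB i))) → ↥tubeSeam := fun z =>
    ⟨⟨(((eW ⟨z, z.2.2⟩ : ↥sphereOffCore) : ↥(beltPiece 3 2)) :
      closedBall (0 : EuclideanSpace ℝ (Fin 4)) 1), hT z⟩,
      (eW ⟨z, z.2.2⟩).2, ((eW ⟨z, z.2.2⟩ : ↥sphereOffCore) : ↥(beltPiece 3 2)).2⟩
  have hinv : ∀ z, tubeSeamToSphereOffCore (inv z) = eW ⟨z, z.2.2⟩ := fun z => rfl
  refine ⟨{ toFun := fun y => ⟨_, hA y, (eW.symm (tubeSeamToSphereOffCore y)).2⟩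
            invFun := inv
            left_inv := fun y => ?_
            right_inv := fun z => ?_
            continuous_toFun := ?_
            continuous_invFun := ?_ }, fun y => rfl, fun y => ?_⟩
  · have e1 : eW ⟨_, (eW.symm (tubeSeamToSphereOffCore y)).2⟩ = tubeSeamToSphereOffCore y := by
      rw [show (⟨_, (eW.symm (tubeSeamToSphereOffCore y)).2⟩ : ↥(bX.incl ⁻¹' range (D.jB i))) =
        eW.symm (tubeSeamToSphereOffCore y) from Subtype.ext rfl, Homeomorph.apply_symm_apply]
    apply Subtype.ext; apply Subtype.ext
    exact congrArg (fun b : ↥sphereOffCore => ((b : ↥(beltPiece 3 2)) :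
      closedBall (0 : EuclideanSpace ℝ (Fin 4)) 1)) e1
  · apply Subtype.ext
    show ((eW.symm (tubeSeamToSphereOffCore (inv z)) : ↥(bX.incl ⁻¹' range (D.jB i))) :
      bX.carrier) = z
    rw [hinv, Homeomorph.symm_apply_apply]
  · exact (continuous_subtype_val.comp (eW.symm.continuous.comp
      continuous_tubeSeamToSphereOffCore)).subtype_mk _
  · refine Continuous.subtype_mk (Continuous.subtype_mk (continuous_subtype_val.comp
      (continuous_subtype_val.comp (eW.continuous.comp ?_))) _) _
    exact (continuous_subtype_val).subtype_mk _
  · show bX.incl (eW.symm (tubeSeamToSphereOffCore y)) = _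
    rw [heW', jA_invPt_eq_jB]

end Overlap

/-! ## §2 The seam quotient from the models -/

section Feeds

variable {Y : Type} [TopologicalSpace Y] {A B : Set Y}

/-- **The overlap feeds the piece.**  If `A ∩ B ≃ₜ tubeSeam` over `B ≃ₜ sphereOffCore` and
`H₁(tubeSeam) → H₁(sphereOffCore)` is onto with kernel `ℤ · [ℓ]`, then `H₁(A ∩ B) → H₁(B)` is onto and
the image in `H₁(A)` of its kernel is `ℤ · [ℓ pushed into A]`. [cite: HatcherAT2002, §2.2 p. 149] -/
theorem overlap_feeds (eT : ↥tubeSeam ≃ₜ ↥(A ∩ B)) (eW' : ↥sphereOffCore ≃ₜ ↥B)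
    (hsq : (subsetInclusion (inter_subset_right : A ∩ B ⊆ B)).comp (eT : C(↥tubeSeam, ↥(A ∩ B))) =
      (eW' : C(↥sphereOffCore, ↥B)).comp toSphereC)
    (hM3 : Function.Surjective (singularHomology.map ℤ ℤ toSphereC 1))
    (hM4 : LinearMap.ker (singularHomology.map ℤ ℤ toSphereC 1).hom =
      Submodule.span ℤ {loopClass ℤ ℤ (1 : ℤ) (loopPath modelLong continuous_modelLong)}) :
    Function.Surjective (singularHomology.map ℤ ℤ
      (subsetInclusion (inter_subset_right : A ∩ B ⊆ B)) 1) ∧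
    Submodule.map (singularHomology.map ℤ ℤ (subsetInclusion (inter_subset_left : A ∩ B ⊆ A)) 1).hom
      (LinearMap.ker (singularHomology.map ℤ ℤ
        (subsetInclusion (inter_subset_right : A ∩ B ⊆ B)) 1).hom) =
      Submodule.span ℤ {loopClass ℤ ℤ (1 : ℤ) ((loopPath modelLong continuous_modelLong).map
        ((subsetInclusion (inter_subset_left : A ∩ B ⊆ A)).comp (eT : C(↥tubeSeam, ↥(A ∩ B)))).continuous)} := by
  have hTiso : Function.Bijective (singularHomology.map ℤ ℤ (eT : C(↥tubeSeam, ↥(A ∩ B))) 1) := by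
    rw [← singularHomology.mapIso_hom]
    exact (ConcreteCategory.isIso_iff_bijective (singularHomology.mapIso ℤ ℤ eT 1).hom).1 inferInstance
  have hWiso : Function.Bijective (singularHomology.map ℤ ℤ (eW' : C(↥sphereOffCore, ↥B)) 1) := by
    rw [← singularHomology.mapIso_hom]
    exact (ConcreteCategory.isIso_iff_bijective (singularHomology.mapIso ℤ ℤ eW' 1).hom).1
      inferInstance
  have hcompB : (singularHomology.map ℤ ℤ
      (subsetInclusion (inter_subset_right : A ∩ B ⊆ B)) 1).hom ∘ₗ
      (singularHomology.map ℤ ℤ (eT : C(↥tubeSeam, ↥(A ∩ B))) 1).hom =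
      (singularHomology.map ℤ ℤ (eW' : C(↥sphereOffCore, ↥B)) 1).hom ∘ₗ (singularHomology.map ℤ ℤ toSphereC 1).hom := by
    rw [← ModuleCat.hom_comp, ← ModuleCat.hom_comp, ← singularHomology.map_comp,
      ← singularHomology.map_comp, hsq]
  refine ⟨?_, ?_⟩
  · refine Function.Surjective.of_comp (g := (singularHomology.map ℤ ℤ (eT : C(↥tubeSeam, ↥(A ∩ B))) 1).hom) ?_
    change Function.Surjective ((singularHomology.map ℤ ℤ
      (subsetInclusion (inter_subset_right : A ∩ B ⊆ B)) 1).hom ∘ₗ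
      (singularHomology.map ℤ ℤ (eT : C(↥tubeSeam, ↥(A ∩ B))) 1).hom)
    rw [hcompB]
    exact hWiso.2.comp hM3
  · have hk : LinearMap.ker (singularHomology.map ℤ ℤ
        (subsetInclusion (inter_subset_right : A ∩ B ⊆ B)) 1).hom =
        Submodule.map (singularHomology.map ℤ ℤ (eT : C(↥tubeSeam, ↥(A ∩ B))) 1).hom
          (Submodule.span ℤ {loopClass ℤ ℤ (1 : ℤ) (loopPath modelLong continuous_modelLong)}) := by
      rw [← hM4, ← LinearMap.ker_comp_of_ker_eq_bot (singularHomology.map ℤ ℤ toSphereC 1).hom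
        (LinearMap.ker_eq_bot.2 hWiso.1), ← hcompB, LinearMap.ker_comp,
        Submodule.map_comap_eq_of_surjective hTiso.2]
    rw [hk, ← Submodule.map_comp, ← ModuleCat.hom_comp, ← singularHomology.map_comp,
      map_span_loopClass]

/-- **From the design's model statements to (M3), (M4)**: if every class of `H₁(tubeSeam)` is
`a[m] + b[ℓ]`, `[ℓ] ↦ 0` and `[m] ↦` a class of infinite order generating `H₁(sphereOffCore)`, then
`H₁(tubeSeam) → H₁(sphereOffCore)` is onto with kernel `ℤ · [ℓ]`. [cite: Kas1980] -/
theorem ker_and_surjective_of_models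
    (hT : ∀ c : singularHomology ℤ ℤ ↥tubeSeam 1, ∃ a b : ℤ,
      c = a • loopClass ℤ ℤ (1 : ℤ) (loopPath modelMer continuous_modelMer) +
        b • loopClass ℤ ℤ (1 : ℤ) (loopPath modelLong continuous_modelLong))
    (hS0 : singularHomology.map ℤ ℤ toSphereC 1
      (loopClass ℤ ℤ (1 : ℤ) (loopPath modelLong continuous_modelLong)) = 0)
    (hS1 : ∀ a : ℤ, a • singularHomology.map ℤ ℤ toSphereC 1
      (loopClass ℤ ℤ (1 : ℤ) (loopPath modelMer continuous_modelMer)) = 0 → a = 0)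
    (hS2 : ∀ c : singularHomology ℤ ℤ ↥sphereOffCore 1, ∃ a : ℤ,
      c = a • singularHomology.map ℤ ℤ toSphereC 1
        (loopClass ℤ ℤ (1 : ℤ) (loopPath modelMer continuous_modelMer))) :
    Function.Surjective (singularHomology.map ℤ ℤ toSphereC 1) ∧
    LinearMap.ker (singularHomology.map ℤ ℤ toSphereC 1).hom =
      Submodule.span ℤ {loopClass ℤ ℤ (1 : ℤ) (loopPath modelLong continuous_modelLong)} := by
  have hsurj : Function.Surjective (singularHomology.map ℤ ℤ toSphereC 1) := fun c => by
    obtain ⟨a, rfl⟩ := hS2 c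
    exact ⟨a • loopClass ℤ ℤ (1 : ℤ) (loopPath modelMer continuous_modelMer),
      map_zsmul (singularHomology.map ℤ ℤ toSphereC 1).hom a _⟩
  refine ⟨hsurj, le_antisymm (fun c hc => ?_) ?_⟩
  · obtain ⟨a, b, rfl⟩ := hT c
    have hc' : singularHomology.map ℤ ℤ toSphereC 1
        (a • loopClass ℤ ℤ (1 : ℤ) (loopPath modelMer continuous_modelMer) +
          b • loopClass ℤ ℤ (1 : ℤ) (loopPath modelLong continuous_modelLong)) = 0 := hc
    rw [map_add, map_zsmul, map_zsmul, hS0, zsmul_zero, add_zero] at hc'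
    rw [hS1 a hc', zero_zsmul, zero_add]
    exact zsmul_mem (Submodule.subset_span (Set.mem_singleton _)) b
  · rw [Submodule.span_le, Set.singleton_subset_iff, SetLike.mem_coe]
    exact LinearMap.mem_ker.2 hS0

end Feeds

section Quotient

variable {g : ℕ} {l : List ((Fin g ⊕ Fin g → ℤ) × Bool)}
  {h : Fin l.length → HandleAttachingMap 3 2 (Base g)}
  {X : Type} [TopologicalSpace X] [ChartedSpace (EuclideanHalfSpace 4) X]

/-- **The model longitude is carried to the longitude `ℓᵢ`** by `tubeSeam ≃ₜ U ∩ Wᵢ ⊆ U ≃ₜ seamOff h`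
(`jA` is injective and `α` is the identity on the Clifford torus). [cite: Kosinski1993, VI §6] -/
theorem map_modelLong_eq_longClass (D : MultiAttachmentData h (𝓡∂ 4) X)
    (bX : BoundaryData (𝓡∂ 4) X (𝓡 3)) (i : Fin l.length)
    (eU : ↥(bX.incl ⁻¹' range D.jA) ≃ₜ ↥(seamOff h))
    (heU : ∀ y, D.jA ⟨(eU y : Base g), (eU y).2.2⟩ = bX.incl y)
    (f : C(↥tubeSeam, ↥(bX.incl ⁻¹' range D.jA)))
    (hf : ∀ y, bX.incl (f y) =
      D.jA ⟨(h i).toFun (handleInversionPt y.1.1 y.1.2 y.2.2), toFun_invPt_mem_coresComplement D i y⟩) :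
    singularHomology.map ℤ ℤ (eU : C(_, _)) 1
        (loopClass ℤ ℤ (1 : ℤ) ((loopPath modelLong continuous_modelLong).map f.continuous)) =
      longClass D.disjoint i := by
  rw [map_loopClass]
  refine loopClass_eq_of_coe_eq ℤ _ _ (funext fun t => Subtype.ext ?_)
  have e1 := heU (f (modelLong (circlePt t)))
  rw [hf] at e1
  refine (congrArg Subtype.val (D.injective_jA e1)).trans ?_
  show (h i).toFun (handleInversionPt (modelLong (circlePt t)).1.1 (modelLong (circlePt t)).1.2
      (modelLong (circlePt t)).2.2) = (h i).toFun (cliffordPt (circlePt t) baseAngle)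
  congr 1
  apply Subtype.ext; apply Subtype.ext
  exact handleInversion_cliffordVec (circlePt t) baseAngle

/-- **(D) from the models.**  `H₁(bX.carrier; ℤ) ≃ₗ[ℤ] H₁(seamOff h; ℤ) ⧸ ⟨ℓᵢ⟩` for a multi-attachment
of 2-handles on `Base g`, given (M1) the tube seam and (M2) the sphere off the core path connected,
(M3) `H₁(tubeSeam) → H₁(sphereOffCore)` onto and (M4) its kernel `= ℤ · [model longitude]`.
[cite: Kas1980] -/
theorem Kas_seam_quotient_of (hM1 : IsPathConnected (tubeSeam : Set ↥(handleTube 3 2)))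
    (hM2 : IsPathConnected (sphereOffCore : Set ↥(beltPiece 3 2)))
    (hM3 : Function.Surjective (singularHomology.map ℤ ℤ toSphereC 1))
    (hM4 : LinearMap.ker (singularHomology.map ℤ ℤ toSphereC 1).hom =
      Submodule.span ℤ {loopClass ℤ ℤ (1 : ℤ) (loopPath modelLong continuous_modelLong)})
    (D : MultiAttachmentData h (𝓡∂ 4) X) (bX : BoundaryData (𝓡∂ 4) X (𝓡 3)) :
    Nonempty (singularHomology ℤ ℤ bX.carrier 1 ≃ₗ[ℤ]
      (singularHomology ℤ ℤ ↥(seamOff h) 1 ⧸ Submodule.span ℤ (Set.range (longClass D.disjoint)))) := by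
  obtain ⟨hAo, hBo, hcov, hdisj, ⟨eU, heU⟩, heW⟩ := Kas_seamCover D bX
  choose eW heW using heW
  choose eT heT1 heT2 using fun i => exists_homeomorph_tubeSeam D bX i (eW i) (heW i)
  haveI : PathConnectedSpace ↥tubeSeam := isPathConnected_iff_pathConnectedSpace.1 hM1
  haveI : PathConnectedSpace ↥sphereOffCore := isPathConnected_iff_pathConnectedSpace.1 hM2
  have hfeed := fun i => overlap_feeds (A := bX.incl ⁻¹' range D.jA)
    (B := bX.incl ⁻¹' range (D.jB i)) (eT i) (eW i).symm
    (ContinuousMap.ext fun y => Subtype.ext (heT1 i y)) hM3 hM4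
  obtain ⟨hsurj, hker⟩ := surjective_and_ker_cover_of_surjective_right ℤ hAo hBo hdisj hcov
    (fun i => (eT i).surjective.pathConnectedSpace (eT i).continuous)
    (fun i => (eW i).symm.surjective.pathConnectedSpace (eW i).symm.continuous)
    (fun i => (hfeed i).1) (fun i => (hfeed i).2)
  -- `H₁(∂X) ≅ H₁(A) ⧸ span {cᵢ}`, transported along `eU : A ≃ₜ seamOff h`
  have key := fun hN => nonempty_equiv_quot_congr (nonempty_equiv_quot_of_surjective hsurj hker)
    (singularHomology.mapIso ℤ ℤ eU 1).toLinearEquiv (LinearEquiv.refl ℤ _)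
    (N' := Submodule.span ℤ (Set.range (longClass D.disjoint))) hN
  obtain ⟨e⟩ := key (by
    rw [Submodule.map_span, ← range_comp]
    congr 2
    funext i
    exact map_modelLong_eq_longClass D bX i eU heU _ (heT2 i))
  -- the two `ℤ`-module structures on the quotient agree (`Module ℤ _` is a subsingleton)
  exact ⟨by convert e using 2 <;> first | rfl | exact Subsingleton.elim _ _⟩

/-- **(D modulo the models) registered sub-goal stub `stub_Kas_seam_quotient_of`** of
`stub_modelsOn_counts`: Kas' seam quotient `H₁(bX.carrier; ℤ) ≃ₗ[ℤ] H₁(seamOff h; ℤ) ⧸ ⟨ℓᵢ⟩` for a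
multi-attachment of 2-handles on `Base g`, given (M1)–(M4) on the models `tubeSeam`, `sphereOffCore`.
[cite: Kas1980] -/
theorem stub_Kas_seam_quotient_of :
    IsPathConnected (tubeSeam : Set ↥(Literature.Topology.FourManifolds.handleTube 3 2)) →
    IsPathConnected (sphereOffCore : Set ↥(Literature.Topology.FourManifolds.beltPiece 3 2)) →
    Function.Surjective
      (Literature.AlgebraicTopology.SingularHomology.singularHomology.map ℤ ℤ toSphereC 1) →
    LinearMap.ker (Literature.AlgebraicTopology.SingularHomology.singularHomology.map ℤ ℤ toSphereC 1).hom =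
      Submodule.span ℤ {Literature.AlgebraicTopology.SingularHomology.loopClass ℤ ℤ (1 : ℤ)
        (Literature.Topology.FourManifolds.LefschetzBase.loopPath modelLong continuous_modelLong)} →
    ∀ (g : ℕ) (l : List ((Fin g ⊕ Fin g → ℤ) × Bool))
    (h : Fin l.length → Literature.Topology.FourManifolds.HandleAttachingMap 3 2
      (Literature.Topology.FourManifolds.LefschetzBase.Base g))
    (X : Type) [TopologicalSpace X] [T2Space X] [SecondCountableTopology X] [CompactSpace X]
    [ChartedSpace (EuclideanHalfSpace 4) X] [IsManifold (𝓡∂ 4) ∞ X]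
    (D : Literature.Topology.FourManifolds.HandleAttachingMap.MultiAttachmentData h (𝓡∂ 4) X)
    (bX : Literature.Topology.FourManifolds.BoundaryData (𝓡∂ 4) X (𝓡 3)),
    Nonempty (Literature.AlgebraicTopology.SingularHomology.singularHomology ℤ ℤ bX.carrier 1 ≃ₗ[ℤ]
      (Literature.AlgebraicTopology.SingularHomology.singularHomology ℤ ℤ ↥(seamOff h) 1 ⧸
        Submodule.span ℤ (Set.range (longClass D.disjoint)))) :=
  fun hM1 hM2 hM3 hM4 _ _ _ _ _ _ _ _ _ _ D bX => Kas_seam_quotient_of hM1 hM2 hM3 hM4 D bX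

end Quotient



end Summit.SmoothPoincare4.SmoothPoincare4.Theorems.AcyclicBisectionExists.ModpBraidOrbits
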